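import Summits.QuantumFields.YangMills.Theorems.ConvexGribovBodyNonSimplyConnectedLatticeGapDefs
import Literature.MathematicalPhysics.QuantumFieldTheory.LatticeGaugeProofs
import HarnessLib

/-!
# `NonSimplyConnectedLatticeGap` — Peierls summation: the chessboard bound for simple bad chains (CHESS) implies the
# rarity of long bad chains in the shell (P1) (stub `stub_longBadChainsRare_of_chessboard` (RED) of line `Sketch` v12,
# crux stmt-QuantumFields-16405, route `ConvexGribovBody`)

Write `μ_S = wilsonMeasure r.ρ β` for the torus Wilson state on `(2S+1)⁴`, `Ũ = torusLift (2S+1) U` for the periodic lift,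
`shell L = {p | L < ‖x_p‖∞ ≤ 2L}` and `goodExterior r.ρ a L` for the configurations without a long chain of `a`-bad plaquettes
in `shell L` (consecutive base points within `ℓ∞`-distance `2`, end-to-end distance `≥ L / 8`; route Defs file).

* CHESS (hypothesis): for every `a > 0`, `q > 0`, at large `β`, every INJECTIVE chain `c₀, …, c_k` of plaquettes with base
  points in the window `‖x‖∞ + 1 ≤ S` is entirely `a`-bad in `Ũ` with `μ_S`-probability `≤ q^{k+1}`;
* P1 (conclusion): for every `a > 0`, at large `β`, `μ_S(Ũ ∉ goodExterior r.ρ a L) ≤ C e^{−cL}` whenever `2L + 1 ≤ S`.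

Proof (pure measure theory and combinatorics, the Peierls argument):
1. a long bad chain contains an injective long bad chain (a chain of minimal length with the same endpoint condition has no
   repeated plaquette: a repetition could be spliced out, `exists_injective_chain`);
2. a chain with `ℓ∞`-steps `≤ 2` has end-to-end distance `≤ 2k`, so a long chain has `k ≥ L / 16`; shell plaquettes have
   base point in the box `[−2L, 2L]⁴` (exactly `6 (4L+1)⁴` of them, `exists_boxFinset`) and lie in the CHESS window;
3. the chains of `k + 1` plaquettes from a box with steps `≤ 2` are enumerated by a Finset of cardinality
   `≤ 6 (4L+1)⁴ · 3750^k` (`5⁴` displacements × `6` orientations per step, `exists_chainFinset`);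
4. union bound (`measure_iUnion_le`, `measure_biUnion_finset_le`) with `q = e^{−1} / 3750`:
   `μ_S(bad) ≤ ∑_{k ≥ L/16} 6 (4L+1)⁴ 3750^k q^{k+1} ≤ 12 q (4L+1)⁴ e^{−⌊L/16⌋} ≤ 12 q · 24 · 128⁴ · e · e^{−L/32}`
   (`poly_geom_le_exp`: `y⁴/4! ≤ e^y`).

All helper lemmas are `private` (the sibling module of the counting stub COUNT lives in the same namespace).

References: R. Peierls, Proc. Camb. Phil. Soc. 32 (1936) 477 (the counting/summation pattern); E. Seiler, LNP 159 (1982),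
Ch. 3 (chessboard/Peierls estimates in lattice gauge theory).
-/

set_option autoImplicit false

noncomputable section

open MeasureTheory
open Literature.Probability.LatticeModels
open Literature.MathematicalPhysics.QuantumLattice
open Literature.MathematicalPhysics.QuantumFieldTheory (GaugeConfig wilsonMeasure LatticeRep IsCompactSimpleLieGroup
  isProbabilityMeasure_wilsonMeasure)
open Summit.QuantumFields.YangMills.Cruxes.NonSimplyConnectedLatticeGap.Sketch (IsBadPlaquette siteSupNorm shell
  HasLongBadChain goodExterior)

namespace Summit.QuantumFields.YangMills.Theorems.NonSimplyConnectedLatticeGap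

/-! ### The sup-norm of `ℤ⁴` -/

/-- Each coordinate is bounded by the sup-norm. -/
private theorem natAbs_apply_le_siteSupNorm (x : Site 4) (i : Fin 4) : (x i).natAbs ≤ siteSupNorm x :=
  Finset.le_sup (f := fun j => (x j).natAbs) (Finset.mem_univ i)

/-- `‖x‖∞ ≤ n` iff every coordinate is at most `n` in absolute value. -/
private theorem siteSupNorm_le_iff {x : Site 4} {n : ℕ} : siteSupNorm x ≤ n ↔ ∀ i, (x i).natAbs ≤ n := by
  simp [siteSupNorm, Finset.sup_le_iff]

/-- Triangle inequality for the sup-distance. -/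
private theorem siteSupNorm_sub_le (x y z : Site 4) :
    siteSupNorm (x - z) ≤ siteSupNorm (x - y) + siteSupNorm (y - z) := by
  rw [siteSupNorm_le_iff]
  intro i
  have e : (x - z) i = (x - y) i + (y - z) i := by simp
  rw [e]
  exact (Int.natAbs_add_le _ _).trans
    (add_le_add (natAbs_apply_le_siteSupNorm (x - y) i) (natAbs_apply_le_siteSupNorm (y - z) i))

/-! ### Simple chains suffice -/

/-- **A long chain contains an injective long chain.** If `c₀, …, c_k` satisfy `Q`, have `ℓ∞`-steps `≤ 2` and end-to-end
distance `≥ D`, then some INJECTIVE chain satisfies `Q`, has steps `≤ 2` and length `K` with `D ≤ 2K` (take a chain of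
minimal length with end-to-end distance `≥ D`: a repetition `c_i = c_j`, `i < j`, could be spliced out). -/
private theorem exists_injective_chain {Q : ZdPlaquette 4 → Prop} {D k : ℕ} (c : Fin (k + 1) → ZdPlaquette 4)
    (hQ : ∀ i, Q (c i)) (hstep : ∀ i : Fin k, siteSupNorm ((c i.castSucc).1 - (c i.succ).1) ≤ 2)
    (hlong : D ≤ siteSupNorm ((c 0).1 - (c (Fin.last k)).1)) :
    ∃ (K : ℕ) (c' : Fin (K + 1) → ZdPlaquette 4), Function.Injective c' ∧ (∀ i, Q (c' i)) ∧
      (∀ i : Fin K, siteSupNorm ((c' i.castSucc).1 - (c' i.succ).1) ≤ 2) ∧ D ≤ 2 * K := by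
  classical
  -- `ℕ`-indexed presentations of chains of length `K + 1`
  let P : ℕ → (ℕ → ZdPlaquette 4) → Prop := fun K g =>
    (∀ n ≤ K, Q (g n)) ∧ (∀ n < K, siteSupNorm ((g n).1 - (g (n + 1)).1) ≤ 2) ∧ D ≤ siteSupNorm ((g 0).1 - (g K).1)
  -- splicing out a loop `g i = g j`, `i < j ≤ K`
  have hsplice : ∀ (K : ℕ) (g : ℕ → ZdPlaquette 4), P K g → ∀ i j : ℕ, i < j → j ≤ K → g i = g j →
      P (K - (j - i)) (fun n => if n ≤ i then g n else g (n + (j - i))) := by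
    rintro K g ⟨h1, h2, h3⟩ i j hij hj he
    refine ⟨fun n hn => ?_, fun n hn => ?_, ?_⟩
    · dsimp only
      split_ifs with c1
      · exact h1 n (by omega)
      · exact h1 _ (by omega)
    · dsimp only
      by_cases c1 : n + 1 ≤ i
      · rw [if_pos (Nat.le_of_succ_le c1), if_pos c1]
        exact h2 n (by omega)
      by_cases c0 : n ≤ i
      · rw [if_pos c0, if_neg c1]
        have hn : n = i := by omega
        have e1 : g n = g j := by rw [hn, he]
        rw [e1, show n + 1 + (j - i) = j + 1 by omega]
        exact h2 j (by omega)
      · rw [if_neg c0, if_neg c1, show n + 1 + (j - i) = n + (j - i) + 1 by omega]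
        exact h2 _ (by omega)
    · dsimp only
      rw [if_pos (Nat.zero_le i)]
      split_ifs with c1
      · have hK : K - (j - i) = i := by omega
        have hjK : j = K := by omega
        rw [hK, he, hjK]
        exact h3
      · rw [Nat.sub_add_cancel (by omega : j - i ≤ K)]
        exact h3
  -- the given chain, `ℕ`-indexed
  let f : ℕ → ZdPlaquette 4 := fun n => if h : n ≤ k then c ⟨n, Nat.lt_succ_of_le h⟩ else c 0
  have hf : P k f := by
    refine ⟨fun n hn => ?_, fun n hn => ?_, ?_⟩
    · simp only [f, dif_pos hn]
      exact hQ _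
    · simp only [f, dif_pos (Nat.le_of_lt hn), dif_pos (Nat.succ_le_of_lt hn)]
      exact hstep ⟨n, hn⟩
    · simp only [f, dif_pos (Nat.zero_le k), dif_pos (le_refl k)]
      exact hlong
  have hex : ∃ K, ∃ g : ℕ → ZdPlaquette 4, P K g := ⟨k, f, hf⟩
  obtain ⟨g, hg⟩ := Nat.find_spec hex
  -- end-to-end distance of a chain with steps `≤ 2`
  have hdist : ∀ n ≤ Nat.find hex, siteSupNorm ((g 0).1 - (g n).1) ≤ 2 * n := by
    intro n
    induction n with
    | zero => exact fun _ => siteSupNorm_le_iff.2 fun i => by simp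
    | succ n ih =>
      intro hn
      have e1 := ih (Nat.le_of_succ_le hn)
      have e2 := hg.2.1 n (Nat.lt_of_succ_le hn)
      have e3 := siteSupNorm_sub_le (g 0).1 (g n).1 (g (n + 1)).1
      omega
  refine ⟨Nat.find hex, fun i => g i, ?_, fun i => hg.1 i (Nat.le_of_lt_succ i.2), fun i => hg.2.1 i i.2,
    hg.2.2.trans (hdist _ le_rfl)⟩
  -- minimality ⇒ injectivity
  intro s t hst
  by_contra hne
  have hs := s.2
  have ht := t.2
  rcases Nat.lt_or_gt_of_ne (fun e => hne (Fin.ext e)) with hlt | hlt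
  · exact Nat.find_min hex (show Nat.find hex - (t - s) < Nat.find hex by omega)
      ⟨_, hsplice _ g hg s t hlt (by omega) hst⟩
  · exact Nat.find_min hex (show Nat.find hex - (s - t) < Nat.find hex by omega)
      ⟨_, hsplice _ g hg t s hlt (by omega) hst.symm⟩

/-! ### Peierls counting -/

-- (membership in a closed `Finset` of plaquettes makes `whnf` evaluate it: raise the recursion limit for this declaration)
set_option maxRecDepth 20000 in
/-- The step alphabet: the `5⁴ · 6 = 3750` plaquettes with base point in `[−2, 2]⁴` (displacement × orientation). -/
private theorem exists_stepFinset : ∃ D : Finset (ZdPlaquette 4), D.card = 3750 ∧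
    ∀ (x : Site 4) (o : {p : Fin 4 × Fin 4 // p.1 < p.2}), siteSupNorm x ≤ 2 → (x, o) ∈ D := by
  refine ⟨(Fintype.piFinset fun _ : Fin 4 => Finset.Icc (-2 : ℤ) 2) ×ˢ Finset.univ, ?_, fun x o hx => ?_⟩
  · have h6 : Fintype.card {p : Fin 4 × Fin 4 // p.1 < p.2} = 6 := by decide
    simp only [Finset.card_product, Fintype.card_piFinset, Finset.prod_const, Finset.card_univ,
      Fintype.card_fin, Int.card_Icc, h6]
    decide
  · refine Finset.mem_product.2 ⟨Fintype.mem_piFinset.2 fun i => Finset.mem_Icc.2 ?_, Finset.mem_univ _⟩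
    have h := (siteSupNorm_le_iff.1 hx) i
    show -2 ≤ x i ∧ x i ≤ 2
    omega

/-- **Peierls counting.** The chains of `k + 1` plaquettes starting in `B` with consecutive base points within
`ℓ∞`-distance `2` lie in a Finset of cardinality `≤ |B| · 3750^k` (append one step at a time, `Fin.snoc`). -/
private theorem exists_chainFinset (B : Finset (ZdPlaquette 4)) : ∀ k : ℕ,
    ∃ T : Finset (Fin (k + 1) → ZdPlaquette 4), T.card ≤ B.card * 3750 ^ k ∧
      ∀ c : Fin (k + 1) → ZdPlaquette 4, c 0 ∈ B →
        (∀ i : Fin k, siteSupNorm ((c i.castSucc).1 - (c i.succ).1) ≤ 2) → c ∈ T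
  | 0 => by
    refine ⟨B.image fun p _ => p, ?_, fun c h0 _ => ?_⟩
    · rw [pow_zero, mul_one]
      exact Finset.card_image_le
    · exact Finset.mem_image.2 ⟨c 0, h0, funext fun i => by rw [Fin.fin_one_eq_zero i]⟩
  | k + 1 => by
    obtain ⟨T, hT, hmem⟩ := exists_chainFinset B k
    obtain ⟨D, hD, hDmem⟩ := exists_stepFinset
    refine ⟨(T ×ˢ D).image fun cv => Fin.snoc cv.1 ((cv.1 (Fin.last k)).1 - cv.2.1, cv.2.2), ?_,
      fun c h0 hstep => ?_⟩
    · calc _ ≤ (T ×ˢ D).card := Finset.card_image_le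
        _ = T.card * 3750 := by rw [Finset.card_product, hD]
        _ ≤ B.card * 3750 ^ k * 3750 := Nat.mul_le_mul_right _ hT
        _ = B.card * 3750 ^ (k + 1) := by ring
    · have hinit : Fin.init c ∈ T :=
        hmem (Fin.init c) (by rw [show Fin.init c 0 = c 0 from congrArg c Fin.castSucc_zero]; exact h0)
          fun i => by
            have h := hstep i.castSucc
            rw [Fin.succ_castSucc] at h
            exact h
      have hlast : siteSupNorm ((c (Fin.last k).castSucc).1 - (c (Fin.last (k + 1))).1) ≤ 2 := by
        have h := hstep (Fin.last k)
        rwa [Fin.succ_last] at h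
      refine Finset.mem_image.2 ⟨(Fin.init c, ((c (Fin.last k).castSucc).1 - (c (Fin.last (k + 1))).1,
        (c (Fin.last (k + 1))).2)), Finset.mem_product.2 ⟨hinit, hDmem _ _ hlast⟩, ?_⟩
      show Fin.snoc (Fin.init c) ((Fin.init c (Fin.last k)).1 -
          ((c (Fin.last k).castSucc).1 - (c (Fin.last (k + 1))).1), (c (Fin.last (k + 1))).2) = c
      rw [show Fin.init c (Fin.last k) = c (Fin.last k).castSucc from rfl, sub_sub_cancel, Prod.mk.eta]
      exact Fin.snoc_init_self c

/-- The shell plaquettes lie in the box `[−2L, 2L]⁴ × (orientations)`, a Finset of exactly `6 (4L+1)⁴` plaquettes. -/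
private theorem exists_boxFinset (L : ℕ) : ∃ B : Finset (ZdPlaquette 4), (B.card : ℝ) = 6 * (4 * L + 1) ^ 4 ∧
    ∀ p ∈ shell L, p ∈ B := by
  refine ⟨(Fintype.piFinset fun _ : Fin 4 => Finset.Icc (-(2 * L : ℤ)) (2 * L)) ×ˢ Finset.univ, ?_, fun p hp => ?_⟩
  · have h6 : Fintype.card {p : Fin 4 × Fin 4 // p.1 < p.2} = 6 := by decide
    have hI : (Finset.Icc (-(2 * L : ℤ)) (2 * L)).card = 4 * L + 1 := by
      rw [Int.card_Icc]; omega
    have : ((Fintype.piFinset fun _ : Fin 4 => Finset.Icc (-(2 * L : ℤ)) (2 * L)) ×ˢ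
        (Finset.univ : Finset {p : Fin 4 × Fin 4 // p.1 < p.2})).card = (4 * L + 1) ^ 4 * 6 := by
      simp only [Finset.card_product, Fintype.card_piFinset, Finset.prod_const, Finset.card_univ,
        Fintype.card_fin, hI, h6]
    rw [this]; push_cast; ring
  · refine Finset.mem_product.2 ⟨Fintype.mem_piFinset.2 fun i => Finset.mem_Icc.2 ?_, Finset.mem_univ _⟩
    have h := (siteSupNorm_le_iff.1 hp.2) i
    omega

/-! ### Arithmetic -/

/-- Polynomial × geometric ≤ exponential: `(4L+1)⁴ e^{−k₀} ≤ 24 · 128⁴ · e · e^{−L/32}` when `L ≤ 16 k₀ + 15`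
(from `y⁴ / 4! ≤ e^y` at `y = (4L+1)/128`). -/
private theorem poly_geom_le_exp (L k₀ : ℕ) (hk : L ≤ 16 * k₀ + 15) :
    ((4 : ℝ) * L + 1) ^ 4 * Real.exp (-(k₀ : ℝ)) ≤ 24 * 128 ^ 4 * Real.exp 1 * Real.exp (-(1 / 32 * (L : ℝ))) := by
  have h1 : ((4 : ℝ) * L + 1) ^ 4 ≤ 24 * 128 ^ 4 * Real.exp ((4 * L + 1) / 128) := by
    have h := Real.pow_div_factorial_le_exp ((4 * (L : ℝ) + 1) / 128) (by positivity) 4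
    have h24 : ((Nat.factorial 4 : ℕ) : ℝ) = 24 := by norm_num [Nat.factorial]
    rw [h24, div_pow, div_div, div_le_iff₀ (by positivity)] at h
    linarith
  have h2 : Real.exp (-(k₀ : ℝ)) ≤ Real.exp (15 / 16 - (L : ℝ) / 16) := by
    refine Real.exp_le_exp.2 ?_
    have : (L : ℝ) ≤ 16 * k₀ + 15 := by exact_mod_cast hk
    linarith
  have h3 : Real.exp ((4 * L + 1) / 128) * Real.exp (15 / 16 - (L : ℝ) / 16) =
      Real.exp (121 / 128) * Real.exp (-(1 / 32 * (L : ℝ))) := by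
    rw [← Real.exp_add, ← Real.exp_add]
    congr 1
    ring
  calc ((4 : ℝ) * L + 1) ^ 4 * Real.exp (-(k₀ : ℝ))
      ≤ (24 * 128 ^ 4 * Real.exp ((4 * L + 1) / 128)) * Real.exp (15 / 16 - (L : ℝ) / 16) :=
        mul_le_mul h1 h2 (Real.exp_pos _).le (by positivity)
    _ = 24 * 128 ^ 4 * (Real.exp (121 / 128) * Real.exp (-(1 / 32 * (L : ℝ)))) := by rw [mul_assoc, h3]
    _ ≤ 24 * 128 ^ 4 * (Real.exp 1 * Real.exp (-(1 / 32 * (L : ℝ)))) := by gcongr; norm_num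
    _ = 24 * 128 ^ 4 * Real.exp 1 * Real.exp (-(1 / 32 * (L : ℝ))) := by ring

/-! ### The stub -/

/-- **CHESS ⇒ P1: long bad chains in the shell are exponentially rare under the torus Wilson states** (registered stub
`stub_longBadChainsRare_of_chessboard` (RED) of the skeleton `Cruxes/NonSimplyConnectedLatticeGap/Lines/Sketch.lean` v12 of item
stmt-QuantumFields-16405). With `q = e^{−1}/3750` in CHESS and `β ≥ β₃(a, q)`: rate `c = 1/32`, constant
`C = 12 q · 24 · 128⁴ · e`; see the module docstring for the Peierls summation. -/
theorem stub_longBadChainsRare_of_chessboard : (∀ (G : Type) [Group G] [TopologicalSpace G] [IsTopologicalGroup G] [CompactSpace G] [MeasurableSpace G] [BorelSpace G], Literature.MathematicalPhysics.QuantumFieldTheory.IsCompactSimpleLieGroup G → ∀ r : Literature.MathematicalPhysics.QuantumFieldTheory.LatticeRep G, ∀ a : ℝ, 0 < a → ∀ q : ℝ, 0 < q → ∃ β₃ : ℝ, ∀ β : ℝ, β₃ ≤ β → ∀ (S k : ℕ) (c : Fin (k + 1) → Literature.MathematicalPhysics.QuantumLattice.ZdPlaquette 4), Function.Injective c → (∀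 i, Summit.QuantumFields.YangMills.Cruxes.NonSimplyConnectedLatticeGap.Sketch.siteSupNorm (c i).1 + 1 ≤ S) → ((Literature.MathematicalPhysics.QuantumFieldTheory.wilsonMeasure r.ρ β : MeasureTheory.Measure (Literature.MathematicalPhysics.QuantumFieldTheory.GaugeConfig 4 (2 * S + 1) G)) {V | ∀ i, Summit.QuantumFields.YangMills.Cruxes.NonSimplyConnectedLatticeGap.Sketch.IsBadPlaquette r.ρ a (Literature.MathematicalPhysics.QuantumLattice.torusLift (2 * S + 1) V) (c i)}).toReal ≤ q ^ (k + 1)) → ∀ (G : Type) [Group G] [TopologicalSpace G] [IsTopologicalGroup G] [CompactSpace G] [MeasurableSpace G] [BorelSpace G], Literature.MathematicalPhysics.QuantumFieldTheory.IsCompactSimpleLieGroup G → ∀ r : Literature.MathematicalPhysics.QuantumFieldTheory.LatticeRep G, ∀ a : ℝ, 0 < a → ∃ β₃ : ℝ, ∀ β : ℝ, β₃ ≤ β → ∃ c : ℝ, 0 < c ∧ ∃ C : ℝ, ∀ (L S : ℕ), 2 * L + 1 ≤ S → ((Literature.MathematicalPhysics.QuantumFieldTheory.wilsonMeasure r.ρ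 β : MeasureTheory.Measure (Literature.MathematicalPhysics.QuantumFieldTheory.GaugeConfig 4 (2 * S + 1) G)) {V | Literature.MathematicalPhysics.QuantumLattice.torusLift (2 * S + 1) V ∉ Summit.QuantumFields.YangMills.Cruxes.NonSimplyConnectedLatticeGap.Sketch.goodExterior r.ρ a L}).toReal ≤ C * Real.exp (-(c * L)) := by
  intro hCH G _ _ _ _ _ _ hG r a ha
  -- the per-plaquette ratio `q` with `3750 q = e^{-1}`
  obtain ⟨q, hq0, hq⟩ : ∃ q : ℝ, 0 < q ∧ 3750 * q = Real.exp (-1) := ⟨Real.exp (-1) / 3750, by positivity, by ring⟩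
  obtain ⟨β₃, hβ₃⟩ := hCH G hG r a ha q hq0
  refine ⟨β₃, fun β hβ => ⟨1 / 32, by norm_num, 12 * q * (24 * 128 ^ 4 * Real.exp 1), fun L S h2 => ?_⟩⟩
  have hCS := hβ₃ β hβ S
  set μ : Measure (GaugeConfig 4 (2 * S + 1) G) := wilsonMeasure r.ρ β
  haveI : IsProbabilityMeasure μ := isProbabilityMeasure_wilsonMeasure (d := 4) (L := 2 * S + 1) r.ρ r.continuous β
  obtain ⟨k₀, hk₀, hk₀'⟩ : ∃ k₀ : ℕ, k₀ = L / 16 ∧ L ≤ 16 * k₀ + 15 := ⟨L / 16, rfl, by omega⟩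
  -- the Finsets of starting plaquettes and of admissible chains of length `k₀ + m + 1`
  obtain ⟨B, hBcard, hBmem⟩ := exists_boxFinset L
  choose T hTcard hTmem using fun m : ℕ => exists_chainFinset B (k₀ + m)
  -- the events "the admissible chain `c` is entirely bad"
  let E : (m : ℕ) → (Fin (k₀ + m + 1) → ZdPlaquette 4) → Set (GaugeConfig 4 (2 * S + 1) G) := fun m c =>
    {V | (Function.Injective c ∧ ∀ i, c i ∈ shell L) ∧ ∀ i, IsBadPlaquette r.ρ a (torusLift (2 * S + 1) V) (c i)}
  -- (1)+(2) covering of the bad event by the events of injective admissible chains of length `k₀ + m + 1`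
  have hcover : {V : GaugeConfig 4 (2 * S + 1) G | torusLift (2 * S + 1) V ∉ goodExterior r.ρ a L} ⊆
      ⋃ m : ℕ, ⋃ c ∈ T m, E m c := by
    intro V hV
    have hV' : HasLongBadChain r.ρ a L (torusLift (2 * S + 1) V) := not_not.1 hV
    obtain ⟨k, c, hsh, hbad, hst, hlong⟩ := hV'
    obtain ⟨K, c', hinj, hQ, hst', hD⟩ := exists_injective_chain
      (Q := fun p => p ∈ shell L ∧ IsBadPlaquette r.ρ a (torusLift (2 * S + 1) V) p) c (fun i => ⟨hsh i, hbad i⟩)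
      hst hlong
    have hK : k₀ ≤ K := by omega
    obtain ⟨m, rfl⟩ := Nat.exists_eq_add_of_le hK
    refine Set.mem_iUnion.2 ⟨m, Set.mem_iUnion₂.2 ⟨c', hTmem m c' (hBmem _ (hQ 0).1) hst', ?_⟩⟩
    simp only [E, Set.mem_setOf_eq]
    exact ⟨⟨hinj, fun i => (hQ i).1⟩, fun i => (hQ i).2⟩
  -- (3) CHESS for each admissible chain
  have hE : ∀ (m : ℕ) (c : Fin (k₀ + m + 1) → ZdPlaquette 4), μ (E m c) ≤ ENNReal.ofReal (q ^ (k₀ + m + 1)) := by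
    intro m c
    by_cases h : Function.Injective c ∧ ∀ i, c i ∈ shell L
    · have hwin : ∀ i, siteSupNorm (c i).1 + 1 ≤ S := fun i => by have := (h.2 i).2; omega
      have hb := hCS (k₀ + m) c h.1 hwin
      have e : E m c = {V | ∀ i, IsBadPlaquette r.ρ a (torusLift (2 * S + 1) V) (c i)} := by
        ext V
        simp only [E, Set.mem_setOf_eq]
        exact ⟨fun h' => h'.2, fun h' => ⟨h, h'⟩⟩
      rw [e]
      exact (ENNReal.le_ofReal_iff_toReal_le (measure_ne_top μ _) (by positivity)).2 hb
    · have e : E m c = ∅ := Set.eq_empty_of_forall_notMem fun V hV => h hV.1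
      rw [e, measure_empty]
      exact bot_le
  -- (3) counting
  set A : ℝ := 6 * (4 * L + 1) ^ 4 * q with hA
  have hA0 : 0 ≤ A := by rw [hA]; positivity
  have hcard : ∀ m : ℕ, ((T m).card : ENNReal) * ENNReal.ofReal (q ^ (k₀ + m + 1)) ≤
      ENNReal.ofReal (A * Real.exp (-1) ^ (k₀ + m)) := by
    intro m
    rw [← ENNReal.ofReal_natCast, ← ENNReal.ofReal_mul (by positivity)]
    refine ENNReal.ofReal_le_ofReal ?_
    have hc : ((T m).card : ℝ) ≤ 6 * (4 * L + 1) ^ 4 * 3750 ^ (k₀ + m) := by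
      have h' : ((T m).card : ℝ) ≤ B.card * 3750 ^ (k₀ + m) := by exact_mod_cast hTcard m
      rwa [hBcard] at h'
    calc ((T m).card : ℝ) * q ^ (k₀ + m + 1)
        ≤ 6 * (4 * L + 1) ^ 4 * 3750 ^ (k₀ + m) * q ^ (k₀ + m + 1) := by gcongr
      _ = 6 * (4 * L + 1) ^ 4 * q * (3750 * q) ^ (k₀ + m) := by ring
      _ = A * Real.exp (-1) ^ (k₀ + m) := by rw [hq, hA]
  -- (4) summation
  have hr0 : 0 ≤ Real.exp (-1) := (Real.exp_pos _).le
  have hr1 : Real.exp (-1) < 1 := Real.exp_lt_one_iff.2 (by norm_num)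
  have hsum : HasSum (fun m : ℕ => A * Real.exp (-1) ^ (k₀ + m)) (A * Real.exp (-1) ^ k₀ * (1 - Real.exp (-1))⁻¹) := by
    have e : (fun m : ℕ => A * Real.exp (-1) ^ (k₀ + m)) = fun m => A * Real.exp (-1) ^ k₀ * Real.exp (-1) ^ m := by
      funext m
      ring
    rw [e]
    exact (hasSum_geometric_of_lt_one hr0 hr1).mul_left _
  have hμB : μ {V | torusLift (2 * S + 1) V ∉ goodExterior r.ρ a L} ≤
      ENNReal.ofReal (A * Real.exp (-1) ^ k₀ * (1 - Real.exp (-1))⁻¹) :=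
    calc μ {V | torusLift (2 * S + 1) V ∉ goodExterior r.ρ a L}
        ≤ μ (⋃ m : ℕ, ⋃ c ∈ T m, E m c) := measure_mono hcover
      _ ≤ ∑' m, μ (⋃ c ∈ T m, E m c) := measure_iUnion_le _
      _ ≤ ∑' m, ∑ c ∈ T m, μ (E m c) :=
        ENNReal.tsum_le_tsum fun m => measure_biUnion_finset_le _ _
      _ ≤ ∑' m, ∑ c ∈ T m, ENNReal.ofReal (q ^ (k₀ + m + 1)) :=
        ENNReal.tsum_le_tsum fun m => Finset.sum_le_sum fun c _ => hE m c
      _ = ∑' m, ((T m).card : ENNReal) * ENNReal.ofReal (q ^ (k₀ + m + 1)) := by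
        simp only [Finset.sum_const, nsmul_eq_mul]
      _ ≤ ∑' m, ENNReal.ofReal (A * Real.exp (-1) ^ (k₀ + m)) := ENNReal.tsum_le_tsum fun m => hcard m
      _ = ENNReal.ofReal (A * Real.exp (-1) ^ k₀ * (1 - Real.exp (-1))⁻¹) := by
        rw [← ENNReal.ofReal_tsum_of_nonneg (fun m => mul_nonneg hA0 (pow_nonneg hr0 _)) hsum.summable, hsum.tsum_eq]
  -- (4) arithmetic
  have hfin : A * Real.exp (-1) ^ k₀ * (1 - Real.exp (-1))⁻¹ ≤
      12 * q * (24 * 128 ^ 4 * Real.exp 1) * Real.exp (-(1 / 32 * (L : ℝ))) := by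
    have he2 : Real.exp (-1) ≤ 1 / 2 := by
      have h1 := Real.add_one_le_exp (1 : ℝ)
      have h2 : Real.exp (-1) * Real.exp 1 = 1 := by rw [← Real.exp_add]; norm_num
      nlinarith [Real.exp_pos (-1 : ℝ)]
    have hinv : (1 - Real.exp (-1))⁻¹ ≤ 2 :=
      inv_le_of_inv_le₀ (by norm_num) (by rw [inv_eq_one_div]; linarith)
    have hgeom : Real.exp (-1) ^ k₀ = Real.exp (-(k₀ : ℝ)) := by
      rw [← Real.exp_nat_mul]
      congr 1
      ring
    have hpoly := poly_geom_le_exp L k₀ hk₀'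
    calc A * Real.exp (-1) ^ k₀ * (1 - Real.exp (-1))⁻¹
        ≤ A * Real.exp (-1) ^ k₀ * 2 := by gcongr
      _ = 12 * q * (((4 : ℝ) * L + 1) ^ 4 * Real.exp (-(k₀ : ℝ))) := by rw [hgeom, hA]; ring
      _ ≤ 12 * q * (24 * 128 ^ 4 * Real.exp 1 * Real.exp (-(1 / 32 * (L : ℝ)))) := by gcongr
      _ = 12 * q * (24 * 128 ^ 4 * Real.exp 1) * Real.exp (-(1 / 32 * (L : ℝ))) := by ring
  exact ENNReal.toReal_le_of_le_ofReal (by positivity) (hμB.trans (ENNReal.ofReal_le_ofReal hfin))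

end Summit.QuantumFields.YangMills.Theorems.NonSimplyConnectedLatticeGap

end
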